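import Mathlib
import HarnessLib

/-!
# Item `LrcModEntire` (stmt-NavierStokesRegularity-20428), CLASS road to `stub_twistingTHGerm` — an EXPLICIT UNIVERSAL LYAPUNOV
# WEIGHT for (OSC) in similarity variables, part 0: the DEFINITIONS (constants and closed-form pieces; no theorems)

Cell ns-regularity-ideate, LEAD ns-poloidal-K2-p3 g13 (`--supports stmt-NavierStokesRegularity-20428`; brick (K-w) of the kernel plan agreed with
ns-k2-port-2 g3, OSC-SCALING-NOTE v2 §3 / OSC-LIOUVILLE-g13 §3, crux dir).

THE POINT.  In similarity variables the law (OSC) is `∂_τÔ + ½∂_ξ((ξ + Ŝ)Ô) ≤ ∂_ξξÔ` with `|Ŝ| ≤ A`.  A weight `w > 0` with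
(UW) `w″(ξ) + ½(ξ + s)·w′(ξ) ≤ −γ·w(ξ)` for ALL `ξ` and ALL `|s| ≤ A` (one `γ > 0`), plus Gaussian decay of `w, w′`, makes `M(τ) := ∫Ô w` satisfy
`M′ ≤ −γM` by two integrations by parts, whence the ancient Liouville theorem for (OSC) for EVERY Lipschitz constant of `Ŝ` (port-2's
(K-b)/(K-c)).  Port-2 obtains such a `w` as the principal Neumann eigenfunction of `w″ + ½(ξ−A)w′` (Sturm–Liouville).  This file REMOVES the
spectral input: an explicit, elementary, even `C²` weight works, with `γ = e^{−A²/2}/16`: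
* on `[0, A]`:  `w(ξ) = 1 − γ·H(ξ)`, `H(ξ) = (2/A)((2/A)(e^{Aξ/2} − 1) − ξ)` (so `w′ = −γh`, `h = (2/A)(e^{Aξ/2} − 1)`, `w″ = −γe^{Aξ/2}`, and
  `w″ + ½(ξ−A)w′ = −γ(1 + (ξ/A)(e^{Aξ/2} − 1)) ≤ −γ ≤ −γw` — the point being `h′ − ½(A−ξ)h ≥ 1`);
* on `[A, ∞)`: the `C²`-matched tail `w(ξ) = W_A·exp(−λu − κu²)`, `u = ξ − A`, `λ = γh(A)/W_A`, `κ = (λ² + γe^{A²/2}/W_A)/2 ≤ 1/8`;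
* even extension to `ξ < 0`; worst case `s = −A` suffices on `ξ ≥ 0` because `w′ ≤ 0` there.
Main theorem (part 3 `…OscUniversalWeight`): `exists_universalWeight` — for every `A > 0` there are `γ, κ > 0`, `C ≥ 0` and an even `C²` weight `w > 0`, non-increasing on
`[0,∞)`, with (UW) and `|w|, |w′| ≤ C·e^{−κξ²}` — exactly the hypothesis object of port-2's (K-b).

WHAT THIS IS NOT: not a claim about Navier–Stokes regularity and not the stub — one-variable real analysis (bears_on LADDER-NS N0, item 20428 / crux 19708;
both OPEN).
-/

noncomputable section

-- the summit and its single sub-problem share the name (CONVENTIONS §1), as in every Theorems file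
set_option linter.dupNamespace false

namespace Summit.NavierStokesRegularity.NavierStokesRegularity.Theorems.PoloidalWindowDoorLrcModEntireTwistingTHOscUniversalWeightDefs

open Set Filter Topology MeasureTheory intervalIntegral

/-! ### The constants and the two closed-form pieces -/

variable (A : ℝ)

/-- `γ = e^{−A²/2}/16`. -/
def gam : ℝ := Real.exp (-(A * A / 2)) / 16
/-- `E = e^{A²/2}`. -/
def Ec : ℝ := Real.exp (A * A / 2)
/-- `h(ξ) = (2/A)(e^{Aξ/2} − 1)` (`= H′`). -/
def hf (ξ : ℝ) : ℝ := (2 / A) * (Real.exp (A * ξ / 2) - 1)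
/-- `H(ξ) = (2/A)((2/A)(e^{Aξ/2} − 1) − ξ)` (`= ∫₀^ξ h`). -/
def Hf (ξ : ℝ) : ℝ := (2 / A) * ((2 / A) * (Real.exp (A * ξ / 2) - 1) - ξ)
/-- Left piece `w_L = 1 − γH`. -/
def wL (ξ : ℝ) : ℝ := 1 - gam A * Hf A ξ
/-- `W_A = w_L(A)`. -/
def WA : ℝ := wL A A
/-- `λ = γh(A)/W_A`. -/
def lam : ℝ := gam A * hf A A / WA A
/-- `κ = (λ² + γE/W_A)/2`. -/
def kap : ℝ := (lam A ^ 2 + gam A * Ec A / WA A) / 2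
/-- Tail exponent `q(ξ) = λ(ξ−A) + κ(ξ−A)²`. -/
def qf (ξ : ℝ) : ℝ := lam A * (ξ - A) + kap A * (ξ - A) ^ 2
/-- Right piece `w_R = W_A e^{−q}`. -/
def wR (ξ : ℝ) : ℝ := WA A * Real.exp (-qf A ξ)
/-- `w_R′ = −(λ + 2κ(ξ−A)) w_R`. -/
def wR1 (ξ : ℝ) : ℝ := -(lam A + 2 * kap A * (ξ - A)) * wR A ξ
/-- `w_R″ = ((λ + 2κ(ξ−A))² − 2κ) w_R`. -/
def wR2 (ξ : ℝ) : ℝ := ((lam A + 2 * kap A * (ξ - A)) ^ 2 - 2 * kap A) * wR A ξ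
/-- `w_L″ = −γ e^{Aξ/2}`. -/
def gL (ξ : ℝ) : ℝ := -gam A * Real.exp (A * ξ / 2)
/-- The second derivative profile on `[0,∞)`: `gL` on `[0,A]`, `w_R″` beyond. -/
def Gf (η : ℝ) : ℝ := if η ≤ A then gL A η else wR2 A η
/-- The (even) second derivative `g(ξ) = G(|ξ|)`. -/
def gf (ξ : ℝ) : ℝ := Gf A |ξ|
/-- `w₁ = ∫₀^ξ g` (the first derivative of the weight). -/
def w1 (ξ : ℝ) : ℝ := ∫ s in (0 : ℝ)..ξ, gf A s
/-- **The weight** `w = 1 + ∫₀^ξ w₁`. -/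
def wf (ξ : ℝ) : ℝ := 1 + ∫ s in (0 : ℝ)..ξ, w1 A s


end Summit.NavierStokesRegularity.NavierStokesRegularity.Theorems.PoloidalWindowDoorLrcModEntireTwistingTHOscUniversalWeightDefs
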